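import Summits.AnomalousDissipation.AnomalousDissipation.Theorems.QuarticTightness.Negative.Anatomy
import Summits.AnomalousDissipation.AnomalousDissipation.Theorems.QuarticGate.Negative.MomentumRow

/-!
# Route MomentParity · crux `QuarticTightness` (stmt-AnomalousDissipation-14331), line `horizon-shooting`:
# S12 — NO COMPARISON PRINCIPLE ACROSS VISCOSITIES (the exact monotone floor is FALSE)

Support file of the line lead (prover-line-stmt-AnomalousDissipation-14331-c13-0). Registered calibration stub
`stub_notExactMonotoneFloor` of the skeleton `Cruxes/QuarticTightness/Lines/Ideate3Sketch.lean`; a port of the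
crux-strategist's kernel-checked `Cruxes/QuarticTightness/StrategyCensus.lean §S1 not_exactMonotoneFloor`
(Cruxes files are not importable from `Theorems/`, so the six helpers are copied here).

The one reduction of the gate-relative floor with teeth — "a loud bounded Galerkin-invariant family at `ν₁` with
budgets `(E', ε')` persists at every `0 < ν₂ ≤ ν₁` with the SAME budgets" — is refuted by a Cauchy–Schwarz PEAK
at the critical viscosity. Force `K = kolField 1` (the shear mode `cos(2πx₁)e₀`), amplitude `a = (4π²)⁻¹`,
state `u* = K_a`, budgets `E' = a²/2` (the energy of `u*`) and `ε' = (8π²)⁻¹ = ‖K‖₂√E'` (the Cauchy–Schwarz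
CEILING of injection at energy `≤ E'`). At `ν₁ = 1` the Dirac `δ_{u*}` is an invariant witness with these
budgets (Anatomy §F, `isLadderWitness_dirac_kolState` at every order). At `ν₂ = 1/2` ANY invariant witness
with these budgets realises equality in `∫(K,u)dμ ≤ ‖K‖₂∫‖u‖dμ ≤ ‖K‖₂(∫‖u‖²dμ)^{1/2} ≤ ‖K‖₂√E'` (energy row
`ensembleDissipation_eq_of_polyStationary`: dissipation = mean injection), hence `u = u*` `μ`-a.s. (equality
cases of Cauchy–Schwarz in `L²` and of Jensen), and the linear row against the band test `K` evaluates to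
`(1 − 4π²ν₂a)·½ = ¼ ≠ 0`, contradicting stationarity. The bounded-energy dissipation maximum over invariant
laws PEAKS at the critical viscosity. No new definitions; no theorem here concludes a Theses decl.
-/

noncomputable section

-- `Summit.<Summit>.<Problem>` is the tree's mandated summit-side namespace (CONVENTIONS §2); for this
-- single-conjunct summit the two coincide, so the duplicate is deliberate.
set_option linter.dupNamespace false

namespace Summit.AnomalousDissipation.AnomalousDissipation.Theorems.MomentParityQuarticTightness

open MeasureTheory Filter Topology Set Function
open scoped ENNReal InnerProductSpace RealInnerProductSpace
open Literature.Analysis.FunctionSpaces Literature.Analysis.FunctionSpaces.Torus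
open Literature.Analysis.FluidPDE Literature.Analysis.FluidPDE.Torus
open Summit.AnomalousDissipation.AnomalousDissipation.Theses.MomentParity
open Summit.AnomalousDissipation.AnomalousDissipation.Theorems
open Summit.AnomalousDissipation.AnomalousDissipation.Theorems.QuarticGate.Negative
open Summit.AnomalousDissipation.AnomalousDissipation.Theorems.QuarticTightness.Negative

-- `T3 = T³`, `R3 = ℝ³`, `H3 = H`, `L2T3 = L²(T³; ℝ³)` (sibling crux's abbreviations).
open Summit.AnomalousDissipation.AnomalousDissipation.Theorems.CubicParityLoud.Negative (T3 R3 H3 L2T3)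

section ExactMonotoneRefutation

-- (`norm_toLp_eq_sqrt` is taken from `Literature.Analysis.FluidPDE.Torus`, already open, to avoid the
-- ambiguity with the sibling crux's copy.)
open Summit.AnomalousDissipation.AnomalousDissipation.Theorems.CubicParityLoud.Negative
  (integrable_pairing sq_integral_norm_le)

/-! ## The laminar Dirac of the shear force at the critical viscosity -/

/-- The shear mode is a band test at every level `≥ 1`. -/
theorem isBandTest_kolField_of_le (a : ℝ) {N : ℕ} (hN : 1 ≤ N) : IsBandTest N (kolField a) :=
  ⟨isSmooth_kolField a, isDivFree_kolField a, hasZeroMean_kolField a, fun k hk => by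
    have h := isLevel_kolState a hN k hk
    rwa [mFourierCoeff_congr_ae (coe_kolState_ae a)] at h⟩

/-- The laminar Dirac of Anatomy §F is an INVARIANT witness (all orders at once). -/
theorem isInvariantWitness_dirac_kolState {ν : ℝ} (hν : 0 < ν) {N : ℕ} (hN : 1 ≤ N) :
    IsInvariantWitness (kolField 1) ν N ‖kolState (4 * Real.pi ^ 2 * ν)⁻¹‖
      ((4 * Real.pi ^ 2 * ν)⁻¹ ^ 2 / 2) (8 * Real.pi ^ 2 * ν)⁻¹
      (Measure.dirac (kolState (4 * Real.pi ^ 2 * ν)⁻¹)) := by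
  have h := fun d => isLadderWitness_dirac_kolState hν hN d
  obtain ⟨hp, hl, hb, -, hE, hD⟩ := h 0
  exact ⟨hp, hl, hb, fun m g P hg => (h (P.totalDegree + 1)).2.2.2.1 m g P hg le_rfl, hE, hD⟩

/-! ## The linear row of the shear force against itself -/

/-- Force splitting of the generator pairing: only the force term changes. -/
theorem nsGeneratorPairing_force_split (ν : ℝ) (f f' : T3 → R3) (u : H3) (w : T3 → R3) :
    Torus.nsGeneratorPairing ν f u w =
      Torus.nsGeneratorPairing ν f' u w + ((∫ x, ⟪f x, w x⟫_ℝ) - ∫ x, ⟪f' x, w x⟫_ℝ) := by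
  simp only [Torus.nsGeneratorPairing]
  ring

/-- `∫ ⟪K₁, K₁⟫ = ½`. -/
theorem integral_inner_kolField_one_self : ∫ x, ⟪kolField 1 x, kolField 1 x⟫_ℝ = 1 / 2 := by
  simp_rw [real_inner_self_eq_norm_sq]
  rw [integral_norm_sq_kolField]
  norm_num

/-- The linear row of `K₁` against itself on a state a.e. equal to `K_a`: `(1 − 4π²νa)·½`. -/
theorem nsGeneratorPairing_kolField_one_self {ν a : ℝ} {U : H3}
    (hU : ((U.1 : L2T3) : T3 → R3) =ᵐ[volume] kolField a) :
    Torus.nsGeneratorPairing ν (kolField 1) U (kolField 1) =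
      (1 - 4 * Real.pi ^ 2 * ν * a) * (1 / 2) := by
  rw [nsGeneratorPairing_force_split ν (kolField 1) (kolField (4 * Real.pi ^ 2 * ν * a)) U (kolField 1),
    nsGeneratorPairing_kolField hU (isSmooth_kolField 1), zero_add]
  have hb : ∫ x, ⟪kolField (4 * Real.pi ^ 2 * ν * a) x, kolField 1 x⟫_ℝ =
      (4 * Real.pi ^ 2 * ν * a) * ∫ x, ⟪kolField 1 x, kolField 1 x⟫_ℝ := by
    rw [show kolField (4 * Real.pi ^ 2 * ν * a) = kolField ((4 * Real.pi ^ 2 * ν * a) * 1) by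
      rw [mul_one]]
    simp_rw [kolField_mul, real_inner_smul_left]
    rw [integral_const_mul]
  rw [hb, integral_inner_kolField_one_self]
  ring

/-! ## Below the critical viscosity the Cauchy–Schwarz ceiling is unattainable -/

/-- **Below the critical viscosity the ceiling is unattainable.** No invariant witness of `K₁` at
`ν₂ = 1/2`, any level `N ≥ 1`, any radius, has energy `≤ a²/2` and dissipation `≥ (8π²)⁻¹`
(`a = (4π²)⁻¹`). [folklore] -/
theorem no_invariantWitness_half {N : ℕ} (hN : 1 ≤ N) {R : ℝ} {μ : Measure H3}
    (hμ : IsInvariantWitness (kolField 1) (1 / 2) N R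
      ((4 * Real.pi ^ 2 * (1 : ℝ))⁻¹ ^ 2 / 2) (8 * Real.pi ^ 2 * (1 : ℝ))⁻¹ μ) : False := by
  obtain ⟨hP, hlev, hball, hstat, hE, hD⟩ := hμ
  set a : ℝ := (4 * Real.pi ^ 2 * (1 : ℝ))⁻¹ with ha_def
  have ha : 0 < a := by positivity
  set K : T3 → R3 := kolField 1 with hK_def
  have hK : MemLp K 2 volume := (isSmooth_kolField 1).memLp 2
  set KL : L2T3 := hK.toLp K with hKL_def
  have h2 : Integrable (fun u : H3 => ‖u‖ ^ 2) μ := integrable_norm_pow_of_ae_le hball 2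
  have h1 : Integrable (fun u : H3 => ‖u‖) μ := by
    simpa using integrable_norm_pow_of_ae_le hball 1
  -- (1) energy row: dissipation = mean injection
  have hrow : Torus.ensembleDissipation (1 / 2) μ = ∫ u, Torus.pairing u.1 K ∂μ :=
    ensembleDissipation_eq_of_polyStationary K hK hlev h2 le_rfl (fun m g P hg _ => hstat m g P hg)
  -- (2) the force norm and the ceiling identity `‖K‖₂ √E' = ε'`
  have hKn : ‖KL‖ = Real.sqrt (1 / 2) := by
    rw [hKL_def, Torus.norm_toLp_eq_sqrt hK, hK_def, integral_norm_sq_kolField]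
    norm_num
  have hKn0 : 0 < ‖KL‖ := by rw [hKn]; positivity
  have hsa : Real.sqrt (a ^ 2 / 2) = a * Real.sqrt (1 / 2) := by
    rw [show a ^ 2 / 2 = a ^ 2 * (1 / 2) by ring, Real.sqrt_mul (sq_nonneg a), Real.sqrt_sq ha.le]
  have hceil : ‖KL‖ * Real.sqrt (a ^ 2 / 2) = (8 * Real.pi ^ 2 * (1 : ℝ))⁻¹ := by
    rw [hKn, hsa, show Real.sqrt (1 / 2) * (a * Real.sqrt (1 / 2)) =
      a * (Real.sqrt (1 / 2) * Real.sqrt (1 / 2)) by ring,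
      Real.mul_self_sqrt (by norm_num : (0 : ℝ) ≤ 1 / 2), ha_def]
    field_simp
    ring
  -- (3) the Cauchy–Schwarz chain `ε' ≤ D = I ≤ ‖K‖ s ≤ ‖K‖ √e ≤ ‖K‖ √E' = ε'`
  set s : ℝ := ∫ u, ‖u‖ ∂μ with hs_def
  set e : ℝ := Torus.ensembleEnergy μ with he_def
  have he_int : ∫ u, ‖u‖ ^ 2 ∂μ = e := by rw [he_def]; rfl
  have hI_le : ∫ u, Torus.pairing u.1 K ∂μ ≤ ‖KL‖ * s := by
    have h := integral_mono (integrable_pairing hK h1) (h1.mul_const ‖KL‖)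
      (fun u => (le_abs_self _).trans (Torus.abs_pairing_coe_le hK u))
    rw [integral_mul_const] at h
    linarith
  have he0 : 0 ≤ e := he_int ▸ integral_nonneg fun u => by positivity
  have hs_le : s ≤ Real.sqrt e :=
    (le_abs_self _).trans (Real.abs_le_sqrt (he_int ▸ sq_integral_norm_le h2))
  have hA : (8 * Real.pi ^ 2 * (1 : ℝ))⁻¹ ≤ ‖KL‖ * s := hD.trans (hrow ▸ hI_le)
  have hB : ‖KL‖ * s ≤ ‖KL‖ * Real.sqrt e := mul_le_mul_of_nonneg_left hs_le hKn0.le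
  have hC : ‖KL‖ * Real.sqrt e ≤ ‖KL‖ * Real.sqrt (a ^ 2 / 2) :=
    mul_le_mul_of_nonneg_left (Real.sqrt_le_sqrt hE) hKn0.le
  have h_eq1 : ‖KL‖ * s = ‖KL‖ * Real.sqrt (a ^ 2 / 2) :=
    le_antisymm (hB.trans hC) (by rw [hceil]; exact hA)
  have h_eq2 : ‖KL‖ * Real.sqrt e = ‖KL‖ * Real.sqrt (a ^ 2 / 2) :=
    le_antisymm hC (by rw [hceil]; exact hA.trans hB)
  have hs_eq : s = Real.sqrt (a ^ 2 / 2) := mul_left_cancel₀ hKn0.ne' h_eq1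
  have hsqe : Real.sqrt e = Real.sqrt (a ^ 2 / 2) := mul_left_cancel₀ hKn0.ne' h_eq2
  have he_eq : e = a ^ 2 / 2 := (Real.sqrt_inj he0 (by positivity)).1 hsqe
  have hI_eq : ∫ u, Torus.pairing u.1 K ∂μ = ‖KL‖ * s :=
    le_antisymm hI_le (by rw [h_eq1, hceil, ← hrow]; exact hD)
  -- (4) equality cases, almost everywhere
  have hae1 : ∀ᵐ u ∂μ, Torus.pairing u.1 K = ‖u‖ * ‖KL‖ := by
    have hnn : 0 ≤ᵐ[μ] fun u : H3 => ‖u‖ * ‖KL‖ - Torus.pairing u.1 K :=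
      ae_of_all _ fun u => sub_nonneg.2 ((le_abs_self _).trans (Torus.abs_pairing_coe_le hK u))
    have hint : Integrable (fun u : H3 => ‖u‖ * ‖KL‖ - Torus.pairing u.1 K) μ :=
      (h1.mul_const _).sub (integrable_pairing hK h1)
    have h0 : ∫ u, (‖u‖ * ‖KL‖ - Torus.pairing u.1 K) ∂μ = 0 := by
      rw [integral_sub (h1.mul_const _) (integrable_pairing hK h1), integral_mul_const, hI_eq]
      ring
    filter_upwards [(integral_eq_zero_iff_of_nonneg_ae hnn hint).1 h0] with u hu
    simp only [Pi.zero_apply] at hu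
    linarith
  have hae2 : ∀ᵐ u ∂μ, ‖u‖ = s := by
    have hsplit : (fun u : H3 => (‖u‖ - s) ^ 2) = fun u => ‖u‖ ^ 2 - (2 * s) * ‖u‖ + s ^ 2 := by
      funext u; ring
    have hint : Integrable (fun u : H3 => (‖u‖ - s) ^ 2) μ := by
      rw [hsplit]; exact (h2.sub (h1.const_mul _)).add (integrable_const _)
    have hA : Integrable (fun u : H3 => ‖u‖ ^ 2 - 2 * s * ‖u‖) μ := h2.sub (h1.const_mul _)
    have hvar : ∫ u, (‖u‖ - s) ^ 2 ∂μ = e - s ^ 2 := by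
      rw [hsplit, integral_add hA (integrable_const _), integral_sub h2 (h1.const_mul _),
        integral_const_mul, integral_const, he_int]
      simp only [smul_eq_mul, probReal_univ, one_mul]
      have hss : (∫ u, ‖u‖ ∂μ) = s := hs_def.symm
      linear_combination (-2 * s) * hss
    have hes : e - s ^ 2 = 0 := by
      rw [hs_eq, Real.sq_sqrt (by positivity), he_eq]
      ring
    filter_upwards [(integral_eq_zero_iff_of_nonneg_ae (ae_of_all _ fun u => sq_nonneg (‖u‖ - s))
      hint).1 (hvar.trans hes)] with u hu
    simp only [Pi.zero_apply] at hu
    nlinarith [sq_nonneg (‖u‖ - s)]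
  -- (5) hence `u = K_a` almost everywhere (equality case of Cauchy–Schwarz in `L²`)
  have hcoef : ‖KL‖⁻¹ * s = a := by
    rw [hKn, hs_eq, hsa]
    field_simp
  have hae3 : ∀ᵐ u ∂μ, ((u.1 : L2T3) : T3 → R3) =ᵐ[volume] kolField a := by
    filter_upwards [hae1, hae2] with u hu1 hu2
    have hnorm : ‖(u.1 : L2T3)‖ = ‖u‖ := Submodule.coe_norm u
    have hinner : ⟪(u.1 : L2T3), KL⟫_ℝ = ‖(u.1 : L2T3)‖ * ‖KL‖ := by
      rw [← Torus.pairing_eq_inner hK, hnorm]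
      exact hu1
    have hpar : ‖KL‖ • (u.1 : L2T3) = ‖(u.1 : L2T3)‖ • KL := (inner_eq_norm_mul_iff_real).1 hinner
    have hu_eq : (u.1 : L2T3) = a • KL := by
      have h' : (u.1 : L2T3) = ‖KL‖⁻¹ • (‖(u.1 : L2T3)‖ • KL) := by
        rw [← hpar, smul_smul, inv_mul_cancel₀ hKn0.ne', one_smul]
      rw [h', smul_smul, hnorm, hu2, hcoef]
    rw [hu_eq]
    filter_upwards [Lp.coeFn_smul a KL, hK.coeFn_toLp] with x hx1 hx2
    rw [hx1, Pi.smul_apply, hx2, hK_def, ← kolField_mul, mul_one]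
  -- (6) the linear row against the band test `K` is the constant `(1 − 4π²ν₂a)·½ = ¼ ≠ 0`
  obtain ⟨-, hrowK⟩ := hstat 1 (fun _ => K) (MvPolynomial.X 0) (fun _ => isBandTest_kolField_of_le 1 hN)
  simp only [polyGrad_X] at hrowK
  have hconst : ∀ᵐ u ∂μ, Torus.nsGeneratorPairing (1 / 2) K u K =
      (1 - 4 * Real.pi ^ 2 * (1 / 2) * a) * (1 / 2) := by
    filter_upwards [hae3] with u hu
    rw [hK_def, nsGeneratorPairing_kolField_one_self hu]
  have hval : ∫ u, Torus.nsGeneratorPairing (1 / 2) K u K ∂μ =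
      (1 - 4 * Real.pi ^ 2 * (1 / 2) * a) * (1 / 2) := by
    rw [integral_congr_ae hconst, integral_const]
    simp only [smul_eq_mul, probReal_univ, one_mul]
  have hquarter : (1 - 4 * Real.pi ^ 2 * (1 / 2) * a) * (1 / 2) = 1 / 4 := by
    rw [ha_def]
    field_simp
    ring
  rw [hrowK, hquarter] at hval
  norm_num at hval

/-! ## S12: the exact monotone floor is false -/

/-- **S12 — NO COMPARISON PRINCIPLE ACROSS VISCOSITIES** (registered stub of the line's skeleton, calibration
section; census §Strengthen S1). "A loud bounded Galerkin-invariant family at `ν₁` with budgets `(E', ε')`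
persists at every `0 < ν₂ ≤ ν₁` with the SAME budgets" is FALSE: the laminar Dirac of the shear force
`kolField 1` carries the exact-ceiling budgets `E' = a²/2`, `ε' = (8π²)⁻¹` (`a = (4π²)⁻¹`) at `ν₁ = 1`
(`isInvariantWitness_dirac_kolState`), and nothing carries them at `ν₂ = 1/2` (`no_invariantWitness_half`).
[folklore] -/
theorem stub_notExactMonotoneFloor :
    ¬ ∀ f : T3 → R3, Torus.IsSmooth f → Torus.IsDivFree f → Torus.HasZeroMean f →
      ∀ (E' ε' ν₁ ν₂ : ℝ), 0 < ν₂ → ν₂ ≤ ν₁ →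
      (∃ R : ℝ, ∃ᶠ N in atTop, ∃ μ : Measure H3, IsInvariantWitness f ν₁ N R E' ε' μ) →
      (∃ R : ℝ, ∃ᶠ N in atTop, ∃ μ : Measure H3, IsInvariantWitness f ν₂ N R E' ε' μ) := by
  intro hmono
  have hhyp : ∃ R : ℝ, ∃ᶠ N in atTop, ∃ μ : Measure H3, IsInvariantWitness (kolField 1) 1 N R
      ((4 * Real.pi ^ 2 * (1 : ℝ))⁻¹ ^ 2 / 2) (8 * Real.pi ^ 2 * (1 : ℝ))⁻¹ μ :=
    ⟨_, (eventually_ge_atTop 1).frequently.mono fun N hN =>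
      ⟨_, isInvariantWitness_dirac_kolState one_pos hN⟩⟩
  obtain ⟨R, hR⟩ := hmono (kolField 1) (isSmooth_kolField 1) (isDivFree_kolField 1)
    (hasZeroMean_kolField 1) _ _ 1 (1 / 2) (by norm_num) (by norm_num) hhyp
  obtain ⟨N, ⟨μ, hμ⟩, hN⟩ := (hR.and_eventually (eventually_ge_atTop 1)).exists
  exact no_invariantWitness_half hN hμ

end ExactMonotoneRefutation

end Summit.AnomalousDissipation.AnomalousDissipation.Theorems.MomentParityQuarticTightness

end
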